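import Literature.AlgebraicGeometry.HodgeTheory.WeilClassesDescendingOfLefschetzOneOne
import Literature.AlgebraicGeometry.HodgeTheory.WeilPlaneFibreCharts
import Literature.AlgebraicGeometry.HodgeTheory.ChernCharacterBetti
import HarnessLib

/-!
# A `K`-symmetric class is orthogonal to the Weil plane: `h ⌣ w = 0` for `φ^* h = d·h`, `w ∈ W_K`

Family `hodge`, layer `Literature/AlgebraicGeometry/HodgeTheory`. Everything here is PROVED on the tree's real
carriers (complex Betti cohomology `complexBetti`, the strong Weil plane `weilClassesOf A φ n d = E₊ ⊔ E₋` of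
`WeilClasses.lean`, the cup product `cupProduct` of `AlgebraicTopology/SingularHomology/CupProduct.lean`); no
definition and no named fact is introduced. Requested by the B2b ladder `hodge-weil` (packet
`run/shared/lean/b2b/hodge-weil/`, `LADDER.md ## CARVER v5` C36 (c3): "the identity `cupPowTwo h k ⌣ w = 0` for
`w ∈ weilClassesOf` (`K`-compatible `h`) as a Literature lemma — confirmed numerically at the CM square, not yet
typed"; prover 2 generation 4, `b2b-hweil-pv2-g4/BLOCH-SEEDS.md` §2 (a)).

## The statement and its proof

Let `A` be a complex abelian `2n`-fold (`A.dim = 2n`), `φ : A ⟶ A` with `φ ≫ φ = -(d • 𝟙 A)`, `d ≥ 1`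
(`K = ℚ(√-d) ↪ End⁰(A)`), and `h ∈ H²(A(ℂ); ℂ)` a class with `φ^* h = d·h` — a `K`-SYMMETRIC class: this is the
condition `φ^*H = dH` satisfied by a polarization whose Rosati involution induces complex conjugation on `K`
(Deligne's condition (4.4)/(4.8)(a); van Geemen's `E(φx, φy) = d·E(x, y)`, Lemma 5.2; in the B2b files the
`K`-symmetrised hyperplane class `h_K = d·e^*a + φ^*e^*a`). Then for every `w` in the Weil plane
`weilClassesOf A φ n d ⊆ H^{2n}(A(ℂ); ℂ)`:

  `h ⌣ w = 0` in `H^{2n+2}(A(ℂ); ℂ)`   (`cupProduct_eq_zero_of_map_eq_smul_of_mem_weilClassesOf`).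

PROOF (van Geemen, proof of Lemma 5.2 (6) and of Thm. 6.12, in the exterior-algebra model
`H•(A(ℂ); ℂ) = ⋀• H¹`, which the tree PROVES: `Motives.AbelianVariety.hasExteriorCohomologyH1_complexPoints`,
`Motives.AbelianVariety.finrank_complexBetti_one`). Write `H¹ = V₊ ⊕ V₋` for the `± i√d`-eigenspaces of `φ^*`, each
of dimension `2n` (`two_mul_finrank_eigenspace_eq`, `finrank_eigenspace_eq_finrank_eigenspace_neg`), and choose an
eigenbasis `b = (b₊, b₋)`. In the induced wedge basis `{bᵢ ⌣ bⱼ}_{i<j}` of `H²`, `φ^*` is diagonal with eigenvalue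
`λᵢλⱼ ∈ {(i√d)² = -d, (i√d)(-i√d) = d}` (`cupPowOne_mem_pullbackEigenclasses` at `(x,y) = (0,1)`), so `φ^*h = d·h`
forces every coefficient of `h` on a pair `{i, j}` with `λᵢ = λⱼ` to vanish (`repr_apply_sub_smul_of_diagonal`;
`d ≠ -d`): `h ∈ V₊ ∧ V₋`. The Weil lines are `E₊ = ℂ·(⌣ b₊)`, `E₋ = ℂ·(⌣ b₋)` (`cupPowOne_mem_weilClassesPlus`,
`weilClassesPlus_le_span_singleton`, non-vanishing by `cupPowOne_basis_ne_zero`). Finally `(bᵢ ⌣ bⱼ) ⌣ (⌣ b₊) = 0`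
whenever one of `bᵢ, bⱼ` lies in `b₊` — a repeated degree-one factor (`cupProduct_cupPowOne_cupPowOne`,
`cupPowOne_eq_zero_of_eq`) — and likewise for `b₋`; every surviving pair `{i,j}` has one index in each half. Hence
`h ⌣ E₊ = 0 = h ⌣ E₋` and `h ⌣ w = 0` by bilinearity.

Also recorded: `cupProduct_eq_zero_of_mem_eigenspace_of_mem_weilClassesOf` (membership form of the hypothesis; the
symmetric order `w ⌣ h = 0` is NOT stated — consumers use the given order), and the packet's reading: the Weil plane is orthogonal to every
`K`-symmetric class, in particular PRIMITIVE for a `K`-compatible polarization, and `(q·hⁿ + w) ⌣ h = q·h^{n+1}`.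

## References

* [vanGeemen1994HodgeAV] B. van Geemen, An introduction to the Hodge conjecture for abelian varieties, LNM 1594
  (1994): 4.9 (the Weil plane `⋀^{2n}_K H¹`), Lemma 5.2 and its proof ((6): `E₊ = ⋀^{2n}W'₊`), proof of Thm. 6.12
  (the `SU`-decomposition `⋀^{2n}(W ⊕ W^*) = ⊕ ⋀^a W ⊗ ⋀^{2n-a} W^*`; `E ∈ W ⊗ W^*`).
* [Deligne1982HodgeCycles] P. Deligne, Hodge cycles on abelian varieties, LNM 900 (1982), (4.4) and Thm. 4.8 (a)
  (the polarization whose Rosati involution induces conjugation on `E`).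
* [LangeBirkenhake1992] H. Lange, Ch. Birkenhake, Complex Abelian Varieties, Lemma 1.1.17, Exercise 1.1.6 (7)–(8)
  (`H•(A; ℂ) = ⋀• H¹`), Prop. 1.1.9 (self-conjugacy of the extended rational representation).
-/

noncomputable section

open CategoryTheory

namespace Literature.AlgebraicGeometry.HodgeTheory

open Literature.AlgebraicTopology.SingularHomology

section CupVanishing

variable {R : Type*} [CommRing R] {Y : Type*} [TopologicalSpace Y]

/-- **A product of two iterated products of degree-one classes with a common factor vanishes**:
if `u i = v j` then `(u₀ ⌣ ⋯ ⌣ u_{p-1}) ⌣ (v₀ ⌣ ⋯ ⌣ v_{m-1}) = 0` (`⅟2 ∈ R`) — the product is the iterated product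
of the concatenated family (`cupProduct_cupPowOne_cupPowOne`), which has a repeated entry
(`cupPowOne_eq_zero_of_eq`, graded commutativity in degree one). [cite: Hatcher2002, §3.2 Thm. 3.11 and p. 211] -/
theorem cupProduct_cupPowOne_cupPowOne_eq_zero_of_eq [Invertible (2 : R)] {p m : ℕ}
    (u : Fin p → singularCohomology R R Y 1) (v : Fin m → singularCohomology R R Y 1) (i : Fin p) (j : Fin m)
    (hij : u i = v j) :
    cupProduct rfl (cupPowOne R Y p u) (cupPowOne R Y m v) = 0 := by
  rw [cupProduct_cupPowOne_cupPowOne]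
  refine cupPowOne_eq_zero_of_eq _ _ (Fin.castAdd m i) (Fin.natAdd p j) ?_ ?_
  · rw [Fin.append_left, Fin.append_right, hij]
  · intro h
    have h' := congrArg Fin.val h
    simp only [Fin.val_castAdd, Fin.val_natAdd] at h'
    omega

end CupVanishing

section HodgeTheory

variable {A : Motives.AbelianVariety ℂ}

/-- **A `K`-symmetric class is cup-orthogonal to the Weil plane.** Let `A` be a complex abelian `2n`-fold
(`A.dim = 2n`), `φ ≫ φ = -(d • 𝟙 A)` with `d ≥ 1`, and `h ∈ H²(A(ℂ); ℂ)` with `φ^* h = d·h` (e.g. the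
`K`-symmetrised hyperplane class `d·e^*a + φ^*e^*a`, or any polarization whose Rosati involution induces
conjugation on `K = ℚ(√-d)`). Then `h ⌣ w = 0` for every `w ∈ weilClassesOf A φ n d`. Proof in the exterior model
`H• = ⋀• H¹` (module docstring): `h ∈ V₊ ∧ V₋` while `E± = ⋀²ⁿ V±`, and a wedge with a repeated degree-one factor
vanishes. Van Geemen: "`E ∈ W ⊗ W^*`" and "`E₊ = ⋀²ⁿ W'₊`".
[cite: vanGeemen1994HodgeAV, 4.9, proof of Lemma 5.2 (6) and proof of Thm. 6.12]
[cite: Deligne1982HodgeCycles, (4.4) and Thm. 4.8 (a)] [cite: LangeBirkenhake1992, Lemma 1.1.17 and Prop. 1.1.9] -/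
theorem cupProduct_eq_zero_of_map_eq_smul_of_mem_weilClassesOf {n d : ℕ} (hA : A.dim = 2 * n)
    (hd : 0 < d) {φ : A ⟶ A} (hφ : φ ≫ φ = -(d • 𝟙 A)) {h : complexBetti A.X 2}
    (hh : complexBetti.map φ.hom.hom.hom 2 h = (d : ℂ) • h) {w : complexBetti A.X (2 * n)}
    (hw : w ∈ weilClassesOf A φ n d) {k : ℕ} (hk : 2 + 2 * n = k) :
    cupProduct hk h w = 0 := by
  classical
  subst hk
  have hΛ : HasExteriorCohomologyH1 ℂ (Motives.ComplexPoints A.X) :=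
    Motives.AbelianVariety.hasExteriorCohomologyH1_complexPoints A
  haveI := finite_complexBetti_abelianVariety A 1
  have hb₁ : Module.finrank ℂ (complexBetti A.X 1) = 2 * (2 * n) := by
    rw [Motives.AbelianVariety.finrank_complexBetti_one, hA]
  set μ : ℂ := Complex.I * (Real.sqrt d : ℂ) with hμ
  set T := (complexBetti.map φ.hom.hom.hom 1).hom with hT
  -- `H¹ = V₊ ⊕ V₋`, both of dimension `2n`
  have hp : Module.finrank ℂ (Module.End.eigenspace T μ) = 2 * n := by
    have e := two_mul_finrank_eigenspace_eq hd hφ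
    rw [hb₁] at e
    change 2 * Module.finrank ℂ (Module.End.eigenspace T μ) = 2 * (2 * n) at e
    omega
  have hq : Module.finrank ℂ (Module.End.eigenspace T (-μ)) = 2 * n := by
    have e := finrank_eigenspace_eq_finrank_eigenspace_neg hd hφ
    change Module.finrank ℂ (Module.End.eigenspace T μ) = Module.finrank ℂ (Module.End.eigenspace T (-μ)) at e
    rw [← e, hp]
  have hcompl : IsCompl (Module.End.eigenspace T μ) (Module.End.eigenspace T (-μ)) :=
    isCompl_eigenspace_eigenspace_neg hd hφ
  -- an eigenbasis of `H¹`, the `μ`-vectors first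
  let bp := Module.finBasisOfFinrankEq ℂ _ hp
  let bm := Module.finBasisOfFinrankEq ℂ _ hq
  let b₀ : Module.Basis (Fin (2 * n) ⊕ Fin (2 * n)) ℂ (complexBetti A.X 1) :=
    (bp.prod bm).map (Submodule.prodEquivOfIsCompl _ _ hcompl)
  let b : Module.Basis (Fin (2 * n + 2 * n)) ℂ (complexBetti A.X 1) := b₀.reindex finSumFinEquiv
  have hb_left : ∀ i : Fin (2 * n), b (Fin.castAdd (2 * n) i) = (bp i : complexBetti A.X 1) := by
    intro i
    rw [Module.Basis.reindex_apply, finSumFinEquiv_symm_apply_castAdd]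
    simp only [b₀, Module.Basis.map_apply, Module.Basis.prod_apply, Function.comp_apply,
      LinearMap.inl_apply, Submodule.coe_prodEquivOfIsCompl', Submodule.coe_zero, add_zero, Sum.elim_inl]
  have hb_right : ∀ j : Fin (2 * n), b (Fin.natAdd (2 * n) j) = (bm j : complexBetti A.X 1) := by
    intro j
    rw [Module.Basis.reindex_apply, finSumFinEquiv_symm_apply_natAdd]
    simp only [b₀, Module.Basis.map_apply, Module.Basis.prod_apply, Function.comp_apply,
      LinearMap.inr_apply, Submodule.coe_prodEquivOfIsCompl', Submodule.coe_zero, zero_add, Sum.elim_inr]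
  -- the eigenvalue of `b i`: `μ` on the first half, `-μ` on the second
  let lam : Fin (2 * n + 2 * n) → ℂ := fun i => if (i : ℕ) < 2 * n then μ else -μ
  have hcast_of_lt : ∀ (i : Fin (2 * n + 2 * n)) (hi : (i : ℕ) < 2 * n),
      i = Fin.castAdd (2 * n) ⟨i, hi⟩ := fun i hi => Fin.ext rfl
  have hnat_of_le : ∀ (i : Fin (2 * n + 2 * n)) (hi : ¬ (i : ℕ) < 2 * n),
      i = Fin.natAdd (2 * n) ⟨(i : ℕ) - 2 * n, by omega⟩ := fun i hi =>
    Fin.ext (by simp only [Fin.val_natAdd]; omega)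
  have hb_mem : ∀ i, b i ∈ Module.End.eigenspace T (lam i) := by
    intro i
    by_cases hi : (i : ℕ) < 2 * n
    · have e : lam i = μ := if_pos hi
      rw [e, hcast_of_lt i hi, hb_left]
      exact (bp _).2
    · have e : lam i = -μ := if_neg hi
      rw [e, hnat_of_le i hi, hb_right]
      exact (bm _).2
  -- the two half-wedges `P = ⌣ b₊ ∈ E₊`, `M = ⌣ b₋ ∈ E₋`, and `P ⌣ M ≠ 0`
  let v : Fin (2 * n) → complexBetti A.X 1 := fun i => b (Fin.castAdd (2 * n) i)
  let vm : Fin (2 * n) → complexBetti A.X 1 := fun j => b (Fin.natAdd (2 * n) j)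
  have hv : ∀ i, v i ∈ Module.End.eigenspace T μ := fun i => by
    show b (Fin.castAdd (2 * n) i) ∈ _
    rw [hb_left]; exact (bp i).2
  have hvm : ∀ j, vm j ∈ Module.End.eigenspace T (-μ) := fun j => by
    show b (Fin.natAdd (2 * n) j) ∈ _
    rw [hb_right]; exact (bm j).2
  set P := cupPowOne ℂ (Motives.ComplexPoints A.X) (2 * n) v with hPdef
  set M := cupPowOne ℂ (Motives.ComplexPoints A.X) (2 * n) vm with hMdef
  have hPmem : P ∈ weilClassesPlus A φ n d := cupPowOne_mem_weilClassesPlus hv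
  have hMmem : M ∈ weilClassesMinus A φ n d := cupPowOne_mem_weilClassesMinus hvm
  have hPM : cupProduct rfl P M ≠ 0 := by
    rw [hPdef, hMdef, cupProduct_cupPowOne_cupPowOne, show Fin.append v vm = ⇑b from Fin.append_castAdd_natAdd]
    exact cupPowOne_basis_ne_zero hΛ b
  have hP0 : P ≠ 0 := by
    intro h0; apply hPM; rw [h0, map_zero, LinearMap.zero_apply]
  have hM0 : M ≠ 0 := by
    intro h0; apply hPM; rw [h0, map_zero]
  -- the wedge basis of `H²` and the diagonal action of `φ^*` on it
  let Bw : Module.Basis (Set.powersetCard (Fin (2 * n + 2 * n)) 2) ℂ (complexBetti A.X 2) :=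
    (b.exteriorPower 2).map (hΛ.equiv 2)
  have hBw : ∀ S, Bw S = cupPowOne ℂ (Motives.ComplexPoints A.X) 2
      (b ∘ (Set.powersetCard.ofFinEmbEquiv.symm S)) := by
    intro S
    change hΛ.equiv 2 ((b.exteriorPower 2) S) = _
    rw [exteriorPower.basis_apply, HasExteriorCohomologyH1.equiv_apply, exteriorPower.ιMulti_family,
      wedgeToCup_ιMulti]
  set T₂ := (complexBetti.map φ.hom.hom.hom 2).hom with hT₂
  have hact : ∀ S : Set.powersetCard (Fin (2 * n + 2 * n)) 2,
      T₂ (Bw S) = (lam (Set.powersetCard.ofFinEmbEquiv.symm S 0) *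
        lam (Set.powersetCard.ofFinEmbEquiv.symm S 1)) • Bw S := by
    intro S
    have hmem := cupPowOne_mem_pullbackEigenclasses (A := A) (φ := φ)
      (v := b ∘ (Set.powersetCard.ofFinEmbEquiv.symm S))
      (lam := lam ∘ (Set.powersetCard.ofFinEmbEquiv.symm S)) (fun i => hb_mem _)
    have h01 := (mem_pullbackEigenclasses_iff.mp hmem) 0 1
    simp only [Nat.cast_zero, Nat.cast_one, zero_add, one_mul, zero_smul, one_smul, Fin.prod_univ_two,
      Function.comp_apply] at h01
    rw [hBw]
    exact h01
  -- a coefficient of `h` on a pair with equal eigenvalues vanishes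
  have hcoef : ∀ S : Set.powersetCard (Fin (2 * n + 2 * n)) 2, Bw.repr h S ≠ 0 →
      lam (Set.powersetCard.ofFinEmbEquiv.symm S 0) ≠ lam (Set.powersetCard.ofFinEmbEquiv.symm S 1) := by
    intro S hS heq
    have hdiag := repr_apply_sub_smul_of_diagonal (P := Unit) Bw (fun _ => T₂)
      (fun S _ => lam (Set.powersetCard.ofFinEmbEquiv.symm S 0) * lam (Set.powersetCard.ofFinEmbEquiv.symm S 1))
      (fun _ S => hact S) (fun _ => (d : ℂ)) () h S
    have hzero : T₂ h - (d : ℂ) • h = 0 := by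
      rw [sub_eq_zero]
      exact hh
    rw [hzero, map_zero, Finsupp.zero_apply] at hdiag
    -- `λ₀ = λ₁` gives `λ₀λ₁ = μ² = -d` or `(-μ)² = -d`, and `-d - d ≠ 0`
    have hsq : lam (Set.powersetCard.ofFinEmbEquiv.symm S 0) * lam (Set.powersetCard.ofFinEmbEquiv.symm S 1) =
        -(d : ℂ) := by
      rw [heq]
      have hμ2 : μ * μ = -(d : ℂ) := by rw [← sq, hμ]; exact I_mul_sqrt_sq d
      by_cases hi : ((Set.powersetCard.ofFinEmbEquiv.symm S 1 : Fin (2 * n + 2 * n)) : ℕ) < 2 * n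
      · have e : lam (Set.powersetCard.ofFinEmbEquiv.symm S 1) = μ := if_pos hi
        rw [e]; exact hμ2
      · have e : lam (Set.powersetCard.ofFinEmbEquiv.symm S 1) = -μ := if_neg hi
        rw [e, neg_mul_neg]; exact hμ2
    rw [hsq] at hdiag
    have hne : (-(d : ℂ) - (d : ℂ)) ≠ 0 := by
      rw [← neg_add', neg_ne_zero, ← two_mul]
      exact mul_ne_zero two_ne_zero (Nat.cast_ne_zero.mpr hd.ne')
    rcases mul_eq_zero.mp hdiag.symm with h1 | h1
    · exact hne h1
    · exact hS h1
  -- `h ⌣ P = 0` and `h ⌣ M = 0`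
  have hsum : ∑ S, Bw.repr h S • Bw S = h := Bw.sum_repr h
  have hcupP : cupProduct rfl h P = 0 := by
    rw [← hsum, map_sum, LinearMap.sum_apply]
    refine Finset.sum_eq_zero fun S _ => ?_
    rw [map_smul, LinearMap.smul_apply]
    by_cases hS : Bw.repr h S = 0
    · rw [hS, zero_smul]
    · -- one index of `S` lies in the first half
      have hne := hcoef S hS
      obtain ⟨i₀, hi₀⟩ : ∃ i₀ : Fin 2,
          ((Set.powersetCard.ofFinEmbEquiv.symm S i₀ : Fin (2 * n + 2 * n)) : ℕ) < 2 * n := by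
        by_contra hno
        have h0 : ¬ ((Set.powersetCard.ofFinEmbEquiv.symm S 0 : Fin (2 * n + 2 * n)) : ℕ) < 2 * n :=
          fun h' => hno ⟨0, h'⟩
        have h1 : ¬ ((Set.powersetCard.ofFinEmbEquiv.symm S 1 : Fin (2 * n + 2 * n)) : ℕ) < 2 * n :=
          fun h' => hno ⟨1, h'⟩
        apply hne
        change (if ((Set.powersetCard.ofFinEmbEquiv.symm S 0 : Fin (2 * n + 2 * n)) : ℕ) < 2 * n then μ
            else -μ) =
          (if ((Set.powersetCard.ofFinEmbEquiv.symm S 1 : Fin (2 * n + 2 * n)) : ℕ) < 2 * n then μ else -μ)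
        rw [if_neg h0, if_neg h1]
      have e : (b ∘ (Set.powersetCard.ofFinEmbEquiv.symm S)) i₀ =
          v ⟨(Set.powersetCard.ofFinEmbEquiv.symm S i₀ : ℕ), hi₀⟩ := by
        show b _ = b _
        rw [← hcast_of_lt _ hi₀]
      rw [hBw, hPdef, cupProduct_cupPowOne_cupPowOne_eq_zero_of_eq _ _ i₀ _ e, smul_zero]
  have hcupM : cupProduct rfl h M = 0 := by
    rw [← hsum, map_sum, LinearMap.sum_apply]
    refine Finset.sum_eq_zero fun S _ => ?_
    rw [map_smul, LinearMap.smul_apply]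
    by_cases hS : Bw.repr h S = 0
    · rw [hS, zero_smul]
    · -- one index of `S` lies in the second half
      have hne := hcoef S hS
      obtain ⟨i₁, hi₁⟩ : ∃ i₁ : Fin 2,
          ¬ ((Set.powersetCard.ofFinEmbEquiv.symm S i₁ : Fin (2 * n + 2 * n)) : ℕ) < 2 * n := by
        by_contra hno
        have h0 : ((Set.powersetCard.ofFinEmbEquiv.symm S 0 : Fin (2 * n + 2 * n)) : ℕ) < 2 * n := by
          by_contra h'; exact hno ⟨0, h'⟩
        have h1 : ((Set.powersetCard.ofFinEmbEquiv.symm S 1 : Fin (2 * n + 2 * n)) : ℕ) < 2 * n := by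
          by_contra h'; exact hno ⟨1, h'⟩
        apply hne
        change (if ((Set.powersetCard.ofFinEmbEquiv.symm S 0 : Fin (2 * n + 2 * n)) : ℕ) < 2 * n then μ
            else -μ) =
          (if ((Set.powersetCard.ofFinEmbEquiv.symm S 1 : Fin (2 * n + 2 * n)) : ℕ) < 2 * n then μ else -μ)
        rw [if_pos h0, if_pos h1]
      have e : (b ∘ (Set.powersetCard.ofFinEmbEquiv.symm S)) i₁ =
          vm ⟨(Set.powersetCard.ofFinEmbEquiv.symm S i₁ : ℕ) - 2 * n, by omega⟩ := by
        show b _ = b _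
        rw [← hnat_of_le _ hi₁]
      rw [hBw, hMdef, cupProduct_cupPowOne_cupPowOne_eq_zero_of_eq _ _ i₁ _ e, smul_zero]
  -- `w = a P + c M`
  obtain ⟨y, hy, z, hz, rfl⟩ := Submodule.mem_sup.mp hw
  obtain ⟨a, rfl⟩ := Submodule.mem_span_singleton.mp
    (weilClassesPlus_le_span_singleton hΛ hb₁ hd hφ hPmem hP0 hy)
  obtain ⟨c, rfl⟩ := Submodule.mem_span_singleton.mp
    (weilClassesMinus_le_span_singleton hΛ hb₁ hd hφ hMmem hM0 hz)
  rw [map_add, map_smul, map_smul, hcupP, hcupM, smul_zero, smul_zero, add_zero]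

/-- **Same statement, membership form of the hypothesis**: `h ∈ ker(φ^*|_{H²} - d)` (the `d`-eigenspace of
`φ^*` on `H²(A(ℂ); ℂ)`) and `w ∈ weilClassesOf A φ n d` give `h ⌣ w = 0`.
[cite: vanGeemen1994HodgeAV, proof of Lemma 5.2 (6) and of Thm. 6.12] -/
theorem cupProduct_eq_zero_of_mem_eigenspace_of_mem_weilClassesOf {n d : ℕ} (hA : A.dim = 2 * n)
    (hd : 0 < d) {φ : A ⟶ A} (hφ : φ ≫ φ = -(d • 𝟙 A)) {h : complexBetti A.X 2}
    (hh : h ∈ Module.End.eigenspace (complexBetti.map φ.hom.hom.hom 2).hom (d : ℂ))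
    {w : complexBetti A.X (2 * n)} (hw : w ∈ weilClassesOf A φ n d) {k : ℕ} (hk : 2 + 2 * n = k) :
    cupProduct hk h w = 0 :=
  cupProduct_eq_zero_of_map_eq_smul_of_mem_weilClassesOf hA hd hφ (Module.End.mem_eigenspace_iff.mp hh) hw hk

/-- **Powers of a `K`-symmetric class are cup-orthogonal to the Weil plane**: `hⁱ ⌣ w = 0` for every `i ≥ 1`
(`cupPowTwo h i ⌣ w`, any target degree `s = 2i + 2n`) — `hⁱ = hⁱ⁻¹ ⌣ h` (`cupPowTwo_succ`), associativity
(`cupProduct_assoc`), and `h ⌣ w = 0`. In particular `hⁿ ⌣ w = 0`: the Weil plane pairs to zero with `hⁿ`, so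
`(q·hⁿ + w) ⌣ hⁿ = q·h²ⁿ` — the identity "(c3) `h³ ∧ w = 0`" of the packet's CM-square data at `n = 3`.
[cite: vanGeemen1994HodgeAV, proof of Lemma 5.2 (6) and of Thm. 6.12] [cite: Hatcher2002, §3.2 p. 211] -/
theorem cupProduct_cupPowTwo_eq_zero_of_map_eq_smul_of_mem_weilClassesOf {n d : ℕ} (hA : A.dim = 2 * n)
    (hd : 0 < d) {φ : A ⟶ A} (hφ : φ ≫ φ = -(d • 𝟙 A)) {h : complexBetti A.X 2}
    (hh : complexBetti.map φ.hom.hom.hom 2 h = (d : ℂ) • h) {w : complexBetti A.X (2 * n)}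
    (hw : w ∈ weilClassesOf A φ n d) {i : ℕ} (hi : 0 < i) {s : ℕ} (hs : 2 * i + 2 * n = s) :
    cupProduct hs (cupPowTwo h i) w = 0 := by
  obtain ⟨j, rfl⟩ : ∃ j, i = j + 1 := ⟨i - 1, by omega⟩
  rw [cupPowTwo_succ, cupProduct_assoc (two_mul_add_two j) (rfl : 2 + 2 * n = 2 + 2 * n) hs (by omega),
    cupProduct_eq_zero_of_map_eq_smul_of_mem_weilClassesOf hA hd hφ hh hw rfl, map_zero]

end HodgeTheory

end Literature.AlgebraicGeometry.HodgeTheory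

end
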